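import Summits.QuantumAdvantage.AdviceFreeQNC0.AffBells29Transfer

/-!
# Frame-shadow reduction — part 3/3: §S.7 the `HWide` line — cluster shape forces wide parity (`wideParity_of_shape`), `HShape → HWide`

VERBATIM split (400-line rule) of planner qa-qnc0-p1 g29's `HOME/qa-qnc0-p1/exp29/Shadow29.lean` (sha16 `0a7e49ebba69860e`, 872 lines, farm
rc 0 / 0 sorry / 0 warnings, axioms standard; authored AND proved by the planner seat; landed by qn-prover-3 g15, ask P-29h) into
`AffBells29Shadow.lean` (§S.1–§S.3), `AffBells29Transfer.lean` (§S.4–§S.6), `AffBells29Shape.lean` (§S.7); only the file boundaries, the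
per-file preambles, these header lines and one-line docstrings on undocumented auxiliaries are new.  The planner's module docstring follows.

# Sketch29 / Shadow29 (planner qn-p1 g29, ROUND-28 rev. 3 §6(b)(S3′)(ii), ask P-29h): the FRAME-SHADOW REDUCTION — typed and PROVED

The pure regime (`HPure`, regime II of ROUND-28 §6) reduces to ONE conjecture about WIDE rows.  Fix a width `w`
(think `w = C·log₂ N`).  A row `b` of the affine strategy `(β, c)` is WIDE if `|supp β_b| > w`, NARROW otherwise.  The
`w`-SHADOW `(shadowRow w β, shadowOff w β c)` keeps every narrow row and replaces every wide row by the zero row with offset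
`0` — a bell that ALWAYS fires.  Two facts, both PROVED here:

* `shadow_pointwise` / `shadow_count` (bookkeeping on `targetFormula`): at an odd point `x` where the WIDE ACTIVE rows fire with
  parity `≡` their number (`WideParityAt w β c x`), the strategy and its shadow win or lose TOGETHER; hence
  `affWinCard β c ≤ affWinCard (shadow) + #{x odd : ¬ WideParityAt w β c x}`.
* `juntaLogHard` / `shadow_loses` (from the TREE theorem `AffBells23.ringHardOddCond2`, δ₀ = 0, degree exponent 2): a strategy
  whose every output bit reads `≤ C·log₂ N` input bits wins on at most `θ·2^{N−1}` odd inputs, ONE absolute `θ < 1` for all `C`;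
  the `w`-shadow with `w ≤ C log₂ N` is such a strategy (`readsOnly_shadow`).

Consequently (`shadow_bound`): `affWinCard β c ≤ θ·2^{N−1} + #{x odd : ¬ WideParityAt w β c x}` for EVERY `(β, c)` and every
`w ≤ C log₂ N`, `N ≥ n₀(C)`.  The remaining conjecture of the (NP₁) programme is therefore the typed statement `HWide` below
(«far from frames ∧ few pair-cut points ⇒ wide parity fails on an o(1) fraction of the odd class»), and the WHOLE glue is PROVED here
without window laws: `polyLoss_of_hWide : HWide → AffBellsPolyLoss3` (§S.5) — frames by the tree's `AffBells27.affFrameLoss`, regime I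
(many cut points) by the elementary double count `cutPoints_le` (§S.4: a cut point is a loser or one pair flip from one), regime II by
`HWide` + `shadow_bound`.  §S.6 adds the general TRANSFER PRINCIPLE (`transfer_pointwise/count/bound`, `degHard`: the ring relation sees a strategy only through
the parity of its ACTIVE answer bits, so ANY polylog-degree strategy agreeing with `(β, c)` in active parity a.e. bounds `affWinCard`) and the weaker
conjecture `HAbs` with `hAbs_of_hWide : HWide → HAbs` and `polyLoss_of_hAbs : HAbs → AffBellsPolyLoss3` (PROVED).
Why `HWide` should hold (ROUND-28 §6(b) T1–T5, §6A): balanced proportionality classes fire `≡ |class|`; the free-phase lemma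
(`AffBells29.freePhase_parity`, Expansion29), the subspace / Fourier / ANF-tower lemmas and the single-deletion argument say
window-purity forces the wide classes to be balanced except on near-twin clusters, which far-ness and activity variation kill;
wide rows blind or 1-thin on the coins of `x` are `N^{1−cC}`-rare.

WHAT THIS IS NOT: no claim about the crux `RingDenseResidualLt3`; `HWide` is a conjecture (typed, unproved); separation NOT moved.
-/

noncomputable section

open Classical

namespace Summit.QuantumAdvantage.AdviceFreeQNC0

namespace AffBells29

open Finset Literature.Computability.QuantumComplexity Literature.Computability.QuantumComplexity.RingHLF
open Literature.Computability.MetaComplexity Literature.Computability.MetaComplexity.Smolensky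
open AffBells23 AffBells26 Fib19 AffBells27 AffBells28

variable {N : ℕ}


/-! ### §S.7 The `HWide` LINE, typed: cluster SHAPE at a point forces wide parity (L3, PROVED); `HShape → HWide` (PROVED)

ROUND-28 §6A (T6, the HWide line L1–L4).  At an odd point `x` call a set `𝒞 ⊆ act x` of rows SHIFTABLE by `δ` via the coin pair `{i, j}` if flipping
`{i, j}` leaves the form of every OTHER active row unchanged and adds `δ` to the form of every row of `𝒞` (a PRIVATE CORE PAIR of a free-phase cluster).
If `x` and the flipped point are non-cut, the firing count of `𝒞` has the same parity at phase `0` and at phase `δ`; two successive shifts by the same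
`δ ≠ 0` make it constant over `𝔽₃`, hence `≡ |𝒞|` (T1, pointwise).  So: `GoodPoint` (no cut point at or next to `x`) ∧ `ClusterShape` (the wide active rows
partition into twice-shiftable clusters) ⇒ `WideParityAt`.  `ClusterShape` is a statement about `β` and `x` ALONE (row geometry against the kernel line);
purity enters only through `GoodPoint`, whose failure set is `≤ (N²+1)·#cutPoints`.  Hence `HShape` («far ∧ few cut points ⇒ ClusterShape a.e.») ⇒ `HWide`.
(2026-08-28T20:19Z, qn-p1 g30 A-30a: `HShape` — and `HWide` itself, A-30b — are REFUTED AS TYPED by window-pure run-twin tilings; the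
implication and all lemmas below remain correct, the live forms are `AffBells30.HDrop`/`HBlock` → `AffBells29.HAbs`.) -/

/-- `𝒞` is shiftable by `δ` at `x` via the coin pair `{i, j}`. -/
def ShiftPair (β : Fin N → Fin N → ZMod 3) (x : Fin N → Bool) (𝒞 : Finset (Fin N)) (δ : ZMod 3) (i j : Fin N) : Prop :=
  i ∈ klineZeros x ∧ j ∈ klineZeros x ∧ i ≠ j ∧
    (∀ g ∈ act x, g ∉ 𝒞 → form β (flipAt x {i, j}) g = form β x g) ∧ (∀ g ∈ 𝒞, form β (flipAt x {i, j}) g = form β x g + δ)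

/-- A GOOD CLUSTER at `x`: a set of active rows shiftable by some `δ ≠ 0`, and shiftable by `δ` AGAIN from the shifted point. -/
def GoodCluster (β : Fin N → Fin N → ZMod 3) (x : Fin N → Bool) (𝒞 : Finset (Fin N)) : Prop :=
  𝒞 ⊆ act x ∧ ∃ δ : ZMod 3, δ ≠ 0 ∧ ∃ i j : Fin N, ShiftPair β x 𝒞 δ i j ∧ ∃ i' j' : Fin N, ShiftPair β (flipAt x {i, j}) 𝒞 δ i' j'

/-- **`ClusterShape w β x`** (L1 ∧ L2 at the point): the wide active rows partition into good clusters. -/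
def ClusterShape (w : ℕ) (β : Fin N → Fin N → ZMod 3) (x : Fin N → Bool) : Prop :=
  ∃ s : Finset (Finset (Fin N)), (∀ 𝒞 ∈ s, ∀ 𝒞' ∈ s, 𝒞 ≠ 𝒞' → Disjoint 𝒞 𝒞') ∧ s.biUnion id = wideAct w β x ∧ ∀ 𝒞 ∈ s, GoodCluster β x 𝒞

/-- no cut point at `x` or one coin-pair flip away. -/
def GoodPoint (β : Fin N → Fin N → ZMod 3) (c : Fin N → ZMod 3) (x : Fin N → Bool) : Prop :=
  x ∉ cutPoints β c ∧ ∀ i ∈ klineZeros x, ∀ j ∈ klineZeros x, i ≠ j → flipAt x {i, j} ∉ cutPoints β c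

/-- phase count: rows of `𝒞` that would fire after a common form shift `t`. -/
def phaseCount (β : Fin N → Fin N → ZMod 3) (c : Fin N → ZMod 3) (x : Fin N → Bool) (𝒞 : Finset (Fin N)) (t : ZMod 3) : ℕ :=
  (𝒞.filter fun g => form β x g + t = c g).card

/-- Auxiliary `phaseCount_zero` of the frame-shadow reduction (planner qa-qnc0-p1 g29, `Shadow29.lean`, verbatim). -/
theorem phaseCount_zero (β : Fin N → Fin N → ZMod 3) (c : Fin N → ZMod 3) (x : Fin N → Bool) (𝒞 : Finset (Fin N)) :
    phaseCount β c x 𝒞 0 = fires β c 𝒞 x := by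
  unfold phaseCount fires
  simp only [add_zero]

/-- The three phase counts partition `𝒞`. -/
theorem phaseCount_sum (β : Fin N → Fin N → ZMod 3) (c : Fin N → ZMod 3) (x : Fin N → Bool) (𝒞 : Finset (Fin N)) :
    phaseCount β c x 𝒞 0 + phaseCount β c x 𝒞 1 + phaseCount β c x 𝒞 2 = 𝒞.card := by
  have key1 : ∀ u v : ZMod 3, (¬ u + 0 = v ∧ u + 1 = v) ↔ u + 1 = v := by decide
  have key2 : ∀ u v : ZMod 3, (¬ u + 0 = v ∧ ¬ u + 1 = v) ↔ u + 2 = v := by decide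
  unfold phaseCount
  rw [← card_filter_add_card_filter_not (s := 𝒞) (fun g => form β x g + 0 = c g), add_assoc]
  congr 1
  rw [← card_filter_add_card_filter_not (s := 𝒞.filter fun g => ¬ form β x g + 0 = c g) (fun g => form β x g + 1 = c g),
    filter_filter, filter_filter]
  congr 1
  · congr 1; exact filter_congr fun g _ => (key1 _ _).symm
  · congr 1; exact filter_congr fun g _ => (key2 _ _).symm

/-- A non-cut point keeps its win under a coin-pair flip. -/
theorem rel_iff_of_not_cut (β : Fin N → Fin N → ZMod 3) (c : Fin N → ZMod 3) {x : Fin N → Bool} (hx : IsOdd x) (hnc : x ∉ cutPoints β c)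
    {i j : Fin N} (hi : i ∈ klineZeros x) (hj : j ∈ klineZeros x) (hij : i ≠ j) :
    RingHLF.Rel x (affBell β c x) ↔ RingHLF.Rel (flipAt x {i, j}) (affBell β c (flipAt x {i, j})) := by
  by_contra h
  apply hnc
  rw [cutPoints, mem_filter]
  exact ⟨mem_univ _, hx, i, hi, j, hj, hij, h⟩

/-- **SINGLE SHIFT (PROVED):** at a non-cut odd point, a `δ`-shiftable cluster has the same firing parity at phases `0` and `δ`. -/
theorem phase_shift (hN : 3 ≤ N) (β : Fin N → Fin N → ZMod 3) (c : Fin N → ZMod 3) {x : Fin N → Bool} (hx : IsOdd x)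
    (hnc : x ∉ cutPoints β c) {𝒞 : Finset (Fin N)} (h𝒞 : 𝒞 ⊆ act x) {δ : ZMod 3} {i j : Fin N} (hs : ShiftPair β x 𝒞 δ i j) :
    phaseCount β c x 𝒞 0 % 2 = phaseCount β c x 𝒞 δ % 2 := by
  obtain ⟨hi, hj, hij, hout, hin⟩ := hs
  have hi' : kline x i = false := by rw [klineZeros, mem_filter] at hi; exact hi.2
  have hj' : kline x j = false := by rw [klineZeros, mem_filter] at hj; exact hj.2
  obtain ⟨hodd', hk⟩ := kline_flipPair hN x hx hij hi' hj'
  set x' := flipAt x {i, j} with hx'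
  have hrel := rel_iff_of_not_cut β c hx hnc hi hj hij
  have h1 := targetFormula N hN x hx (affBell β c x)
  have h2 := targetFormula N hN x' hodd' (affBell β c x')
  rw [activeOnes_affBell β c rfl] at h1
  rw [activeOnes_affBell β c hk, hk] at h2
  -- total active parity agrees at x and x'
  have hpar : fires β c (act x) x % 2 = fires β c (act x) x' % 2 := by
    rw [h1, ← hx', h2] at hrel
    omega
  -- split off the cluster
  have hC : (act x).filter (fun g => g ∈ 𝒞) = 𝒞 := by
    rw [filter_mem_eq_inter, inter_eq_right.2 h𝒞]
  have hs1 := fires_split β c (act x) x (fun g => g ∈ 𝒞)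
  have hs2 := fires_split β c (act x) x' (fun g => g ∈ 𝒞)
  rw [hC] at hs1 hs2
  have hout' : fires β c ((act x).filter fun g => ¬ g ∈ 𝒞) x' = fires β c ((act x).filter fun g => ¬ g ∈ 𝒞) x := by
    unfold fires
    congr 1
    refine filter_congr fun g hg => ?_
    rw [mem_filter] at hg
    rw [hout g hg.1 hg.2]
  have hin' : fires β c 𝒞 x' = phaseCount β c x 𝒞 δ := by
    unfold fires phaseCount
    congr 1
    refine filter_congr fun g hg => ?_
    rw [hin g hg]
  rw [phaseCount_zero]
  rw [hs1, hs2, hout', hin'] at hpar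
  omega

/-- **T1 AT A POINT (PROVED):** a good cluster at a good point fires with parity `≡` its size. -/
theorem goodCluster_parity (hN : 3 ≤ N) (β : Fin N → Fin N → ZMod 3) (c : Fin N → ZMod 3) {x : Fin N → Bool} (hx : IsOdd x)
    (hgp : GoodPoint β c x) {𝒞 : Finset (Fin N)} (h : GoodCluster β x 𝒞) : fires β c 𝒞 x % 2 = 𝒞.card % 2 := by
  obtain ⟨h𝒞, δ, hδ, i, j, hs, i', j', hs'⟩ := h
  have hij : i ≠ j := hs.2.2.1
  have hi : i ∈ klineZeros x := hs.1
  have hj : j ∈ klineZeros x := hs.2.1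
  have hi0 : kline x i = false := by rw [klineZeros, mem_filter] at hi; exact hi.2
  have hj0 : kline x j = false := by rw [klineZeros, mem_filter] at hj; exact hj.2
  obtain ⟨hodd', hk⟩ := kline_flipPair hN x hx hij hi0 hj0
  -- first shift at x
  have e1 := phase_shift hN β c hx hgp.1 h𝒞 hs
  -- second shift at x' (non-cut by GoodPoint; act x' = act x)
  have hact : act (flipAt x {i, j}) = act x := by unfold act; rw [hk]
  have e2 := phase_shift hN β c hodd' (hgp.2 i hi j hj hij) (hact ▸ h𝒞) hs'
  -- phase counts at x' are phase counts at x shifted by δ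
  have hshift : ∀ t : ZMod 3, phaseCount β c (flipAt x {i, j}) 𝒞 t = phaseCount β c x 𝒞 (δ + t) := by
    intro t
    unfold phaseCount
    congr 1
    refine filter_congr fun g hg => ?_
    rw [hs.2.2.2.2 g hg, add_assoc]
  rw [hshift, hshift, add_zero] at e2
  have hsum := phaseCount_sum β c x 𝒞
  rw [← phaseCount_zero]
  have key : ∀ d : ZMod 3, d ≠ 0 → d = 1 ∨ d = 2 := by decide
  have hδ12 : δ = 1 ∨ δ = 2 := key δ hδ
  rcases hδ12 with rfl | rfl
  · have e2' : phaseCount β c x 𝒞 1 % 2 = phaseCount β c x 𝒞 2 % 2 := by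
      have : (1 : ZMod 3) + 1 = 2 := by decide
      rw [this] at e2; exact e2
    omega
  · have e2' : phaseCount β c x 𝒞 2 % 2 = phaseCount β c x 𝒞 1 % 2 := by
      have : (2 : ZMod 3) + 2 = 1 := by decide
      rw [this] at e2; exact e2
    omega

/-- `fires` is additive over a disjoint family. -/
theorem fires_biUnion (β : Fin N → Fin N → ZMod 3) (c : Fin N → ZMod 3) (x : Fin N → Bool) (s : Finset (Finset (Fin N)))
    (hd : ∀ 𝒞 ∈ s, ∀ 𝒞' ∈ s, 𝒞 ≠ 𝒞' → Disjoint 𝒞 𝒞') :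
    fires β c (s.biUnion id) x = ∑ 𝒞 ∈ s, fires β c 𝒞 x := by
  unfold fires
  rw [filter_biUnion, card_biUnion]
  · rfl
  · intro 𝒞 h𝒞 𝒞' h𝒞' hne
    exact disjoint_filter_filter (hd 𝒞 h𝒞 𝒞' h𝒞' hne)

/-- **L3 (PROVED): cluster shape at a good point forces wide parity.** -/
theorem wideParity_of_shape (hN : 3 ≤ N) (w : ℕ) (β : Fin N → Fin N → ZMod 3) (c : Fin N → ZMod 3) {x : Fin N → Bool} (hx : IsOdd x)
    (hgp : GoodPoint β c x) (hsh : ClusterShape w β x) : WideParityAt w β c x := by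
  obtain ⟨s, hd, hU, hgood⟩ := hsh
  unfold WideParityAt
  have hcard : (s.biUnion id).card = ∑ 𝒞 ∈ s, (𝒞 : Finset (Fin N)).card :=
    card_biUnion (fun 𝒞 h𝒞 𝒞' h𝒞' hne => hd 𝒞 h𝒞 𝒞' h𝒞' hne)
  rw [← hU, fires_biUnion β c x s hd, hcard, Finset.sum_nat_mod, Finset.sum_nat_mod (s := s) (f := fun u => u.card)]
  congr 1
  exact sum_congr rfl fun 𝒞 h𝒞 => goodCluster_parity hN β c hx hgp (hgood 𝒞 h𝒞)

/-- The bad points of `GoodPoint` are within one pair flip of a cut point: `≤ (N²+1)·#cutPoints`. -/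
theorem card_not_goodPoint_le (β : Fin N → Fin N → ZMod 3) (c : Fin N → ZMod 3) :
    (univ.filter fun x : Fin N → Bool => ¬ GoodPoint β c x).card ≤ (N ^ 2 + 1) * (cutPoints β c).card := by
  have hsub : (univ.filter fun x : Fin N → Bool => ¬ GoodPoint β c x) ⊆ cutPoints β c ∪ (cutPoints β c).biUnion fun y =>
      ((univ : Finset (Fin N)) ×ˢ (univ : Finset (Fin N))).image fun p => flipAt y ({p.1, p.2} : Finset (Fin N)) := by
    intro x hx
    rw [mem_filter] at hx
    rw [mem_union]
    by_cases hc : x ∈ cutPoints β c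
    · exact Or.inl hc
    · right
      have hx2 := hx.2
      unfold GoodPoint at hx2
      simp only [not_and, not_forall, exists_prop, not_not] at hx2
      obtain ⟨i, hi, j, hj, hij, hcut⟩ := hx2 hc
      rw [mem_biUnion]
      refine ⟨flipAt x {i, j}, hcut, ?_⟩
      rw [mem_image]
      exact ⟨(i, j), by simp, flipAt_flipAt x {i, j}⟩
  refine le_trans (card_le_card hsub) (le_trans (card_union_le _ _) ?_)
  have hb : ((cutPoints β c).biUnion fun y =>
      ((univ : Finset (Fin N)) ×ˢ (univ : Finset (Fin N))).image fun p => flipAt y ({p.1, p.2} : Finset (Fin N))).card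
      ≤ (cutPoints β c).card * N ^ 2 := by
    refine le_trans card_biUnion_le ?_
    rw [← smul_eq_mul, ← sum_const]
    refine sum_le_sum fun y _ => le_trans card_image_le ?_
    rw [card_product, card_univ, Fintype.card_fin, sq]
  nlinarith [hb]

/-- **POINT COUNT (PROVED):** `#{x odd : ¬WideParityAt} ≤ #{x odd : ¬ClusterShape} + (N²+1)·#cutPoints`. -/
theorem card_not_wideParity_le (hN : 3 ≤ N) (w : ℕ) (β : Fin N → Fin N → ZMod 3) (c : Fin N → ZMod 3) :
    (univ.filter fun x : Fin N → Bool => IsOdd x ∧ ¬ WideParityAt w β c x).card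
      ≤ (univ.filter fun x : Fin N → Bool => IsOdd x ∧ ¬ ClusterShape w β x).card + (N ^ 2 + 1) * (cutPoints β c).card := by
  refine le_trans ?_ (Nat.add_le_add_left (card_not_goodPoint_le β c) _)
  refine le_trans (card_le_card ?_) (card_union_le _ _)
  intro x hx
  rw [mem_filter] at hx
  rw [mem_union, mem_filter, mem_filter]
  by_cases hsh : ClusterShape w β x
  · by_cases hgp : GoodPoint β c x
    · exact absurd (wideParity_of_shape hN w β c hx.2.1 hgp hsh) hx.2.2
    · exact Or.inr ⟨mem_univ _, hgp⟩
  · exact Or.inl ⟨mem_univ _, hx.2.1, hsh⟩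

/-- **`HShape`** — L1 ∧ L2 of the HWide line as ONE measure statement: far affine strategies with few cut points have cluster shape at all but an
`ε`-fraction of the odd class.  (About `β` against the kernel line only; `c` enters through the hypothesis.)  Why it might fail: a.e.-purity might be
achievable by wide rows that do NOT organise into twice-privately-shiftable proportional clusters (heavily overlapping cores with no private coin pairs;
cores of `≤ 3` coins) — none known; lit's exhaustive design searches (K-40/K-41L) find only free-phase clusters.
**[REFUTED AS TYPED — informal, qn-p1 g30 A-30a / qn-lit g30 K-44 v1, 2026-08-28: the window-pure run-twin tilings RT₆⋆ are far, have no
cut points and admit no private `ShiftPair`, so `ClusterShape` fails a.e.; superseded by the certificate / drop-set / block-balance forms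
`AffBells30.HCert` → `HDrop` → `HBlock` of HOME/qa-qnc0-p1/exp30/Cert30.lean (ROUND-29); the PROVED lemmas of this file stay.]** -/
def HShape : Prop :=
  ∃ δ₀ : ℝ, δ₀ < 1 / 2 ∧ ∃ r₀ w₀ : ℕ, ∀ ε : ℝ, 0 < ε → ∃ C a n₀ : ℕ, ∀ N ≥ n₀, ∀ (β : Fin N → Fin N → ZMod 3) (c : Fin N → ZMod 3),
    ¬ FrameDecomp δ₀ r₀ w₀ β →
    ((cutPoints β c).card : ℝ) ≤ (2 : ℝ) ^ (N - 1) / (N : ℝ) ^ a →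
      (((univ.filter fun x : Fin N → Bool => IsOdd x ∧ ¬ ClusterShape (C * Nat.log 2 N) β x).card : ℝ) ≤ ε * (2 : ℝ) ^ (N - 1))

/-- **`HShape → HWide` (PROVED).** -/
theorem hWide_of_hShape (h : HShape) : HWide := by
  obtain ⟨δ₀, hδ₀, r₀, w₀, hS⟩ := h
  refine ⟨δ₀, hδ₀, r₀, w₀, fun ε hε => ?_⟩
  have hε2 : (0 : ℝ) < ε / 2 := by linarith
  obtain ⟨C, a, n₀, hS⟩ := hS (ε / 2) hε2
  obtain ⟨M, hM⟩ := exists_nat_gt (4 / ε)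
  refine ⟨C, max a 3, max (max n₀ 3) M, fun N hN β c hfr hcut => ?_⟩
  have hN₀ : n₀ ≤ N := le_trans (le_trans (le_max_left _ _) (le_max_left _ _)) hN
  have h3 : 3 ≤ N := le_trans (le_trans (le_max_right _ _) (le_max_left _ _)) hN
  have hNM : M ≤ N := le_trans (le_max_right _ _) hN
  have hNpos : (0 : ℝ) < N := by exact_mod_cast (show 0 < N by omega)
  have hN1 : (1 : ℝ) ≤ N := by exact_mod_cast (show 1 ≤ N by omega)
  have h2pow : (0 : ℝ) < (2 : ℝ) ^ (N - 1) := by positivity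
  -- feed HShape: #cut ≤ 2^{N-1}/N^{max a 3} ≤ 2^{N-1}/N^a
  have hpow_a : (N : ℝ) ^ a ≤ (N : ℝ) ^ (max a 3) := pow_le_pow_right₀ hN1 (le_max_left _ _)
  have hpow_3 : (N : ℝ) ^ 3 ≤ (N : ℝ) ^ (max a 3) := pow_le_pow_right₀ hN1 (le_max_right _ _)
  have hNa : (0 : ℝ) < (N : ℝ) ^ a := by positivity
  have hcut' : ((cutPoints β c).card : ℝ) ≤ (2 : ℝ) ^ (N - 1) / (N : ℝ) ^ a :=
    le_trans hcut (div_le_div_of_nonneg_left h2pow.le hNa hpow_a)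
  have h1 := hS N hN₀ β c hfr hcut'
  have h2 : ((univ.filter fun x : Fin N → Bool => IsOdd x ∧ ¬ WideParityAt (C * Nat.log 2 N) β c x).card : ℝ)
      ≤ ((univ.filter fun x : Fin N → Bool => IsOdd x ∧ ¬ ClusterShape (C * Nat.log 2 N) β x).card : ℝ)
        + ((N : ℝ) ^ 2 + 1) * (cutPoints β c).card := by
    exact_mod_cast card_not_wideParity_le h3 (C * Nat.log 2 N) β c
  -- (N^2+1)·2^{N-1}/N^{max a 3} ≤ 2N^2 · 2^{N-1}/N^3 = 2·2^{N-1}/N ≤ (ε/2)·2^{N-1}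
  have hN2 : (2 : ℝ) ≤ N := by exact_mod_cast (show 2 ≤ N by omega)
  have hεN : 4 / (N : ℝ) ≤ ε := by
    have hNt : 4 / ε < (N : ℝ) := lt_of_lt_of_le hM (by exact_mod_cast hNM)
    rw [div_le_iff₀ hNpos]
    have := (div_lt_iff₀ hε).1 hNt
    linarith
  have h3pos : (0 : ℝ) < (N : ℝ) ^ (max a 3) := by positivity
  have hterm : ((N : ℝ) ^ 2 + 1) * (cutPoints β c).card ≤ (ε / 2) * (2 : ℝ) ^ (N - 1) := by
    have hA : ((N : ℝ) ^ 2 + 1) * (cutPoints β c).card ≤ ((N : ℝ) ^ 2 + 1) * ((2 : ℝ) ^ (N - 1) / (N : ℝ) ^ (max a 3)) :=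
      mul_le_mul_of_nonneg_left hcut (by positivity)
    have hB : ((N : ℝ) ^ 2 + 1) * ((2 : ℝ) ^ (N - 1) / (N : ℝ) ^ (max a 3)) ≤ 2 * (N : ℝ) ^ 2 * ((2 : ℝ) ^ (N - 1) / (N : ℝ) ^ 3) := by
      have hC : (N : ℝ) ^ 2 + 1 ≤ 2 * (N : ℝ) ^ 2 := by nlinarith
      have hD : (2 : ℝ) ^ (N - 1) / (N : ℝ) ^ (max a 3) ≤ (2 : ℝ) ^ (N - 1) / (N : ℝ) ^ 3 :=
        div_le_div_of_nonneg_left h2pow.le (by positivity) hpow_3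
      exact mul_le_mul hC hD (by positivity) (by positivity)
    have hE : 2 * (N : ℝ) ^ 2 * ((2 : ℝ) ^ (N - 1) / (N : ℝ) ^ 3) = (4 / (N : ℝ)) / 2 * (2 : ℝ) ^ (N - 1) := by
      field_simp
      ring
    rw [hE] at hB
    have hF : (4 / (N : ℝ)) / 2 * (2 : ℝ) ^ (N - 1) ≤ (ε / 2) * (2 : ℝ) ^ (N - 1) :=
      mul_le_mul_of_nonneg_right (by linarith) h2pow.le
    linarith
  linarith


end AffBells29

end Summit.QuantumAdvantage.AdviceFreeQNC0
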